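import Literature.NumberTheory.EllipticCurves.IwasawaLocalKummerQuotientProofs
import HarnessLib

/-!
# The level-`0` local tower kernel vanishes when the restriction kernel on the whole local Galois
# group has no `p`-power torsion (row T-T3B, file F5b; team n1011, seat p12 GEN 8)

HONEST FRAMING (cell `b2b-bsdres`, run/shared/lean/b2b/bsd-rank1-residual/, verbatim in every
file): the goal of the cell is to DELETE the COMBINATION-SHAPED residual classes of the
Birch–Swinnerton-Dyer formula for ALL analytic-rank `≤ 1` elliptic curves over `ℚ` — "full BSD
formula for every rank `≤ 1` curve in class `C`" assembled STRICTLY from published theorems — so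
that the rank-`≤ 1` remainder becomes exactly the CONSTRUCTION-SHAPED classes, which are TYPED
(missing-input `Prop`s), NOT attempted. This is not "finishing BSD". Team n1011 (N10/N11; row
T-T3B = the `v = p` local tower kernel at level `0` for additive potentially good ordinary
reduction, skeleton `cells/n1011/skel/T-T3B.md`): research routes on CONSTRUCTION-SHAPED classes;
prove what is provable now; no claim beyond stated classes; census output = EVIDENCE, never a
Literature fact; RESIDUAL-MAP marks UNCHANGED; nothing is booked by this file. TOOL THEOREMS ONLY:
no definition, no named fact, nothing cited enters as a hypothesis.

## What (generic: any field `K`, any `ℤ_p`-extension `κ`, any Weierstrass curve `W/K`, any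
`K`-field `E`)

`WeierstrassCurve.localTowerKerPrimary_zero_eq_bot_of_forall_subgroupResKer_eq_zero`: if every
`p`-power-torsion class of the restriction kernel
`ker (H¹(Γ_E, E(K̄_E)) → H¹(H_{E,∞}, E(K̄_E)))` (`subgroupResKer (localPoints W E) (localSubgroup (ker κ) E)`)
is zero, then the `p`-power torsion of the level-`0` local tower kernel
`𝒦_{E,0} = ker (H¹(H_{E,0}, E(K̄_E)) → H¹(H_{E,∞}, E(K̄_E)))` vanishes:
`W.localTowerKerPrimary κ E 0 = ⊥`. This is the `= ⊥` form of the tree's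
`WeierstrassCurve.finite_localTowerKerPrimary_zero_of_finite_primary_subgroupResKer`
(`IwasawaLocalKummerQuotientProofs`; Greenberg LNM 1716 §3 p. 86, the maps `r_v` at `n = 0`): the
same bijection `H¹(Γ_E, ·) ≃ H¹(H_{E,0}, ·)` (`bijective_resH1Hom_subgroupIncl`, `H_{E,0} = Γ_E`)
compatible with the two restrictions (`resH1Hom_comp`). It is the last step of row T-T3B's END
(`Additive/LocalTowerKernelAtPTwistedOrdinary`), where the hypothesis is supplied by
`ResKernelPrimary.exists_kerValued_cocycle_of_pow_smul_eq_zero` (F1) and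
`KummerCount.oneCocycleClass_eq_zero_of_kerValued` (F2).

References: [GreenbergLNM1716] R. Greenberg, LNM 1716 (1999), §3 p. 86 (the maps `r_{v_n}`),
Lemma 3.4 (p. 89); J.-P. Serre, *Galois Cohomology* (1997), I.§2.4.
-/

noncomputable section

open scoped Classical

universe u

namespace WeierstrassCurve

open Literature.NumberTheory.EllipticCurves Literature.NumberTheory.EllipticCurves.ResKernel

variable {K : Type u} [Field K] (W : WeierstrassCurve K) {p : ℕ} [Fact p.Prime]
  (κ : ZpExtension K p) (E : Type u) [Field E] [Algebra K E]

/-- **`𝒦_{E,0}[p^∞] = 0` when the restriction kernel on `Γ_E` has no `p`-power torsion.** With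
`H_{E,0} = (Γ_E → Γ_K)⁻¹(Gal(K̄/K_0)) = Γ_E` and `H_{E,∞} = (Γ_E → Γ_K)⁻¹(Gal(K̄/K_∞))`: if every
`x ∈ ker (H¹(Γ_E, E(K̄_E)) → H¹(H_{E,∞}, E(K̄_E)))` (`subgroupResKer`) with `p ^ k • x = 0` is
zero, then `W.localTowerKerPrimary κ E 0 = ⊥`, along the bijection
`H¹(Γ_E, ·) ≃ H¹(H_{E,0}, ·)` (`bijective_resH1Hom_subgroupIncl`) compatible with the restrictions
to `H_{E,∞}` (`resH1Hom_comp`) — verbatim the map of the tree's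
`finite_localTowerKerPrimary_zero_of_finite_primary_subgroupResKer`. Greenberg, LNM 1716, §3 p. 86
(the maps `r_v` at `n = 0`). [cite: GreenbergLNM1716, §3 p. 86] -/
theorem localTowerKerPrimary_zero_eq_bot_of_forall_subgroupResKer_eq_zero
    (h : ∀ x : discreteH1 (Field.absoluteGaloisGroup E) (localPoints W E),
      x ∈ subgroupResKer (localPoints W E) (localSubgroup κ.kerSubgroup E) →
        ∀ k : ℕ, p ^ k • x = 0 → x = 0) :
    W.localTowerKerPrimary κ E 0 = ⊥ := by
  let P : Type u := localPoints W E
  let H0 : Subgroup (Field.absoluteGaloisGroup E) := localSubgroup (κ.layerSubgroup 0) E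
  let Hi : Subgroup (Field.absoluteGaloisGroup E) := localSubgroup κ.kerSubgroup E
  have hmem0 : ∀ σ : Field.absoluteGaloisGroup E, σ ∈ H0 := fun σ ↦ by
    change σ ∈ localSubgroup (κ.layerSubgroup 0) E
    rw [mem_localSubgroup_iff, ZpExtension.layerSubgroup_zero]
    exact Subgroup.mem_top _
  have hle : Hi ≤ H0 := localSubgroup_ker_le_layer κ E 0
  -- the bijection `r : H¹(Γ_E, P) → H¹(H_{E,0}, P)`
  let r : discreteH1 (Field.absoluteGaloisGroup E) P →+ discreteH1 H0 P :=
    resH1Hom (Literature.NumberTheory.EllipticCurves.subgroupIncl H0) (AddMonoidHom.id P)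
      (fun _ _ ↦ rfl)
  have hr : Function.Bijective r := bijective_resH1Hom_subgroupIncl P H0 hmem0
  have hcomp : (Literature.NumberTheory.EllipticCurves.resOfLe P hle).comp r = resSubgroup Hi P := by
    unfold Literature.NumberTheory.EllipticCurves.resOfLe ResKernel.resSubgroup
    rw [resH1Hom_comp]
    exact resH1Hom_congr (ContinuousMonoidHom.ext fun _ ↦ rfl) (AddMonoidHom.ext fun _ ↦ rfl) _ _
  -- every element of `𝒦_{E,0}[p^∞]` is zero
  refine (AddSubgroup.eq_bot_iff_forall _).mpr fun c hc ↦ ?_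
  obtain ⟨hcker, k, hk⟩ := (W.mem_localTowerKerPrimary_iff κ E 0 c).mp hc
  obtain ⟨y, hy⟩ := hr.2 c
  have hyker : y ∈ subgroupResKer P Hi := by
    rw [ResKernel.mem_subgroupResKer_iff, ← hcomp, AddMonoidHom.comp_apply, hy]
    exact (W.mem_localTowerKer_iff κ E 0 _).mp hcker
  have hyk : p ^ k • y = 0 := hr.1 (by rw [map_nsmul, hy, hk, map_zero])
  rw [← hy, h y hyker k hyk, map_zero]

end WeierstrassCurve

end
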